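import Summits.BirchSwinnertonDyer.BirchSwinnertonDyer.Theorems.CMKolyvaginAtInertTwoPairSupplyLevelMapsAtTwo
import Summits.BirchSwinnertonDyer.BirchSwinnertonDyer.Theorems.CMKolyvaginAtInertTwoPairOfRatDataAAtTwo
import HarnessLib

/-!
# Route `CMKolyvaginAtInertTwo`, crux `CMKolyvaginExactAtInertTwo` (stmt-BirchSwinnertonDyer-24277):
# SUPPLIER of the two-member data, II — Kolyvagin's classes OVER `ℚ` at level `2^M` from a `K`-point system
# of level `2^{M+1}`: descent, Lemma 4.3 at EVERY finite place, Prop. 4.4 across the pair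

Seat `bsd-line-cmk2-p1` g18 (cell `bsd-print-cf2`); helper (`--supports stmt-BirchSwinnertonDyer-24277`).
THEOREMS ONLY: no definition, no named fact, no `sorry`; no item is closed; BSD is not proved by this.

KERNEL-STATUS §17.7 asks for `D : PairDataM (H¹(ℚ,E[2^M])) (H¹(ℚ,E^{(d_K)}[2^M])) (places ℚ)`. Its classes
are built here from ty2's `K`-side datum `D' : PointSystem N W K P 2 S (M+1)` (one level DEEPER, Kolyvagin
primes of depth `M+1`) as follows. `c'_K(m) = cK W σ (M+1) hdiv' D' m ∈ H¹(K, E_K[2^{M+1}])` is `τ`-eigen with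
sign `ε(−1)^{r(m)}` (`cK_mem_eigK`, Gross 5.4 (2)), hence — `E(K)[2^{M+1}] = 0` — a UNIQUE class over `ℚ` of `E`
(sign `+`: `res u' = c'_K(m)`) or of `E^{(d_K)}` (sign `−`: `ψ(res y') = c'_K(m)`) at level `2^{M+1}`
(`EigenClassesFinite`); the supplier's classes are `[2]_* u'`, `[2]_* y'` at level `2^M`. THEN:

* §1 `exists_resTorsion_eq_cK` / `exists_hPsiKT_resTorsion_eq_cK` — the descents at level `2^{M+1}`;
* §2 **Lemma 4.3 over `ℚ` at EVERY finite place `v ∤ m` and at `∞`** for `[2]_* u'`, `[2]_* y'`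
  (`torsionH1ZSMul_mem_loc₁_of_notDv`, `torsionH1ZSMul_twin_mem_loc₂_of_notDv`): Gross 6.2 (1) over `K` at
  level `2^{M+1}` (field `rel` of `D'`) + Dokchitser–Dokchitser's «`res ξ` Selmer over `K` ⟹ `[2]_* ξ` Selmer
  over `ℚ`» (`torsionH1ZSMul_two_mem_selmerLocalKer_of_forall_liesOver`) — NO case split split/inert/ramified,
  in particular no DEF-condition at `q ∣ d_K` (KERNEL-STATUS §17.2: `#E(ℚ_q)[2] = 2` on H₂);
* §3 **the Kolyvagin relation at level `2^M` over `K`** for the classes `[2]_* c'_K` at `λ ∣ ℓ`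
  (`zsmul_torsionH1ZSMul_cK_mem_selmerLocalKer_iff`): Gross 6.2 (2) at level `2^{M+1}` with multiplier
  `2^{a+1}`, read through `[2]_*` — on the Selmer side by `torsionH1ZSMul_mem_selmerLocalKer_iff`, on the strict
  side by `torsionH1ZSMul_mem_torsionLocalKer_iff_of_fixed`, `Γ_{K_λ}` fixing `E[2^{M+1}]` at a depth-`(M+1)`
  Kolyvagin prime of good reduction (`absGaloisRestrict_smul_geomTorsion_eq_of_kolyvaginPrime_pow`);
* §4 **Prop. 4.4 ACROSS the pair over `ℚ` at level `2^M`** in the currency `loc₁/loc₂/a₁/a₂/pl` of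
  `GenusExact.VisiblePairAtTwo` (`zsmul_torsionH1ZSMul_twin_mem_loc₂_iff_mem_a₁`,
  `zsmul_torsionH1ZSMul_mem_loc₁_iff_twin_mem_a₂`): §3 + the LINE 6 dictionary of gk2-p3
  (`SelmerDescent.zsmul_twist_mem_selmerLocalKer_iff_zsmul_mem_torsionLocalKer_of_K` and its twin) with the
  level-`2^M` descent identities `res ([2]_* u') = [2]_* c'_K`, `ψ(res ([2]_* y')) = [2]_* c'_K`
  (`resTorsion_torsionH1ZSMul`, `hPsiKT_resTorsion_torsionH1ZSMul`).

Support predicate throughout: `Kol ℓ := IsKolyvaginPrime N W K 2 ℓ ∧ FrobEqFrobInfty W K (2^{M+1}) ℓ ∧ kolPrime W K M ℓ`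
(the consumer's `hDKol` with `M = 2L`). References: [GrossLMS1991] (4.4), Props. 5.4 (2), 6.2; [McCallumLMS1991]
§4 Lemma 4.3, Prop. 4.4, Lemma 4.6; [Kolyvagin1989Izv] §3; [DokchitserDokchitserAnnals2010] Lemma 4.14 (proof).
-/

-- single-conjunct summit: `Summit.BirchSwinnertonDyer.BirchSwinnertonDyer.…` repeats the name by design
set_option linter.dupNamespace false
set_option autoImplicit false

noncomputable section

open scoped Classical

namespace Summit.BirchSwinnertonDyer.BirchSwinnertonDyer.Theorems.KolyvaginPairSupplyTwo

open WeierstrassCurve NumberField IsDedekindDomain Field Rat.HeightOneSpectrum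
open Literature.NumberTheory.EllipticCurves Literature.NumberTheory.GaloisRepresentations
open Literature.NumberTheory.EllipticCurves.KolyvaginDescent
open Summit.BirchSwinnertonDyer.Rank1Residual.P2.KolyvaginMachine
open Summit.BirchSwinnertonDyer.BirchSwinnertonDyer.Theorems.KolyvaginPairDataTwo
open Summit.BirchSwinnertonDyer.BirchSwinnertonDyer.Theorems.GenusExact.VisiblePairAtTwo
open Summit.BirchSwinnertonDyer.BirchSwinnertonDyer.Theorems.GenusExact.EigenClassesFinite
open Summit.BirchSwinnertonDyer.BirchSwinnertonDyer.Theorems.GenusExact.SelmerDescent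
open Summit.BirchSwinnertonDyer.BirchSwinnertonDyer.Theorems.GenusExact.TwinGrossPrimes

/-! ## §0 Levels -/

/-- `2^{M+1} ∣ 2^M · 2` (the divisibility hypothesis of `[2]_* : H¹(·, E[2^{M+1}]) → H¹(·, E[2^M])`). [folklore] -/
theorem lvl_succ_dvd (M : ℕ) : (lvl (M + 1) : ℤ) ∣ lvl M * 2 :=
  ⟨1, by simp [lvl, pow_succ]⟩

/-- `2^M ∣ 2^{M+1}` (the hypothesis of `ι_*`). [folklore] -/
theorem two_pow_dvd_two_pow_succ (M : ℕ) : 2 ^ M ∣ 2 ^ (M + 1) := pow_dvd_pow 2 M.le_succ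

/-- `2^a · 2 = 2^{a+1}` with the casts of the point system. [folklore] -/
theorem natCast_two_pow_mul_two (a : ℕ) : (((2 : ℕ) : ℤ) ^ a) * 2 = ((2 : ℕ) : ℤ) ^ (a + 1) := by
  push_cast; ring

variable {N : ℕ} (W : WeierstrassCurve ℚ) {K : Type} [Field K] [NumberField K]
  (c : K ≃ₐ[ℚ] K) (M : ℕ)
  (hdiv' : ∀ Q : geomPoints (W.baseChange K), ∃ R, ((2 ^ (M + 1) : ℕ) : ℤ) • R = Q)
  {S : ℕ → Prop} {P : (W.baseChange K).toAffine.Point}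

/-! ## §1 The descents at level `2^{M+1}` -/

section Descent

variable (h2 : Module.finrank ℚ K = 2) {θ : K} (hθ : θ ∉ Set.range (algebraMap ℚ K))
  (hd : θ ^ 2 = algebraMap ℚ K ((NumberField.discr K : ℤ) : ℚ))

/-- **Descent to `E` at level `2^{M+1}`** of a `K`-class with `σ₀·y = y` when `E(K)[2^{M+1}] = 0`: the class of
`H¹(ℚ, E[2^{M+1}])` restricting to it (exists, unique). [cite: GrossLMS1991, §5 (5.1)] -/
theorem exists_resTorsion_eq_of_conjAct_eq
    (hL : ∀ Q : (W.baseChange K).toAffine.Point, (lvl (M + 1) : ℤ) • Q = 0 → Q = 0)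
    {y : galH1Torsion (W.baseChange K) (lvl (M + 1))}
    (hy : conjAct W (sigmaQ K h2 hθ hd) (lvl (M + 1)) y = y) :
    ∃ u' : galH1Torsion W (lvl (M + 1)), resTorsion W K (lvl (M + 1)) u' = y :=
  (existsUnique_resTorsion_eq_of_conjAct_eq W K h2 hθ hd (lvl (M + 1)) hL hy).exists

/-- **Descent to `E^{(d_K)}` at level `2^{M+1}`** of a `K`-class with `σ₀·y = −y` when `E(K)[2^{M+1}] = 0`.
[cite: GrossLMS1991, §5 (5.1)] [cite: Kolyvagin1989Izv, §3] -/
theorem exists_hPsiKT_resTorsion_eq_of_conjAct_eq_neg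
    (hL : ∀ Q : (W.baseChange K).toAffine.Point, (lvl (M + 1) : ℤ) • Q = 0 → Q = 0)
    {y : galH1Torsion (W.baseChange K) (lvl (M + 1))}
    (hy : conjAct W (sigmaQ K h2 hθ hd) (lvl (M + 1)) y = -y) :
    ∃ y' : galH1Torsion (twin W K) (lvl (M + 1)),
      hPsiKT W K hθ hd (lvl (M + 1)) (resTorsion (twin W K) K (lvl (M + 1)) y') = y :=
  (exists_hPsiKT_resTorsion_eq_iff_conjAct_eq_neg W K h2 hθ hd (lvl (M + 1)) hL y).mpr hy

/-- **Kolyvagin's class `c'_K(m)` of the point system descends at level `2^{M+1}`**: to `E` when its sign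
`ε(−1)^{r(m)}` is `+1`, to `E^{(d_K)}` when it is `−1` (Gross 5.4 (2) for the sign, `E(K)[2^{M+1}] = 0` for
the descent). [cite: GrossLMS1991, Prop. 5.4 (2) and §5 (5.1)] [cite: Kolyvagin1989Izv, §3] -/
theorem exists_descent_cK (D' : PointSystem N W K P 2 S (M + 1) hdiv' (sigmaQ K h2 hθ hd))
    (hL : ∀ Q : (W.baseChange K).toAffine.Point, (lvl (M + 1) : ℤ) • Q = 0 → Q = 0) {m : ℕ}
    (hm : KolSupp (fun ℓ ↦ IsKolyvaginPrime N W K 2 ℓ ∧ FrobEqFrobInfty W K (2 ^ (M + 1)) ℓ ∧ S ℓ) m) :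
    (D'.ε * (-1) ^ m.primeFactors.card = 1 →
      ∃ u' : galH1Torsion W (lvl (M + 1)),
        resTorsion W K (lvl (M + 1)) u' = cK W (sigmaQ K h2 hθ hd) (M + 1) hdiv' D' m) ∧
    (D'.ε * (-1) ^ m.primeFactors.card = -1 →
      ∃ y' : galH1Torsion (twin W K) (lvl (M + 1)),
        hPsiKT W K hθ hd (lvl (M + 1)) (resTorsion (twin W K) K (lvl (M + 1)) y') =
          cK W (sigmaQ K h2 hθ hd) (M + 1) hdiv' D' m) := by
  have hsgn := (mem_eigK_iff W _ _ _ _).mp (cK_mem_eigK W (sigmaQ K h2 hθ hd) (M + 1) hdiv' D' hm)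
  refine ⟨fun h1 ↦ ?_, fun h1 ↦ ?_⟩
  · rw [h1, one_zsmul] at hsgn
    exact exists_resTorsion_eq_of_conjAct_eq W M h2 hθ hd hL hsgn
  · rw [h1, neg_one_zsmul] at hsgn
    exact exists_hPsiKT_resTorsion_eq_of_conjAct_eq_neg W M h2 hθ hd hL hsgn

end Descent

/-! ## §2 Lemma 4.3 over `ℚ` at every place `v ∤ m`, for the level-`2^M` classes `[2]_* u'`, `[2]_* y'` -/

section Lemma43

variable (D' : PointSystem N W K P 2 S (M + 1) hdiv' c)

/-- Gross 6.2 (1) over `K` at level `2^{M+1}` (field `rel` of the point system): `c'_K(m)` is Selmer at every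
finite `v ∤ m`. [cite: GrossLMS1991, Prop. 6.2 (1)] -/
theorem cK_mem_selmerLocalKer_of_notMem {m : ℕ}
    (hm : KolSupp (fun ℓ ↦ IsKolyvaginPrime N W K 2 ℓ ∧ FrobEqFrobInfty W K (2 ^ (M + 1)) ℓ ∧ S ℓ) m)
    (w : HeightOneSpectrum (𝓞 K)) (hw : (m : 𝓞 K) ∉ w.asIdeal) :
    cK W c (M + 1) hdiv' D' m ∈ selmerLocalKer (W.baseChange K) (w.adicCompletion K) (lvl (M + 1)) :=
  (D'.rel m hm.1 hm.2).2.1 w hw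

omit [NumberField K] in
/-- `(m : 𝓞 ℚ) ∉ v ⟹ (m : 𝓞 K) ∉ w` for `w ∣ v`. [folklore] -/
theorem natCast_notMem_of_liesOver [NumberField K] {m : ℕ} {v : HeightOneSpectrum (𝓞 ℚ)}
    (hv : (m : 𝓞 ℚ) ∉ v.asIdeal) (w : HeightOneSpectrum (𝓞 K)) (hw : w.asIdeal.LiesOver v.asIdeal) :
    (m : 𝓞 K) ∉ w.asIdeal := by
  intro h
  apply hv
  rw [hw.over, Ideal.under_def, Ideal.mem_comap, map_natCast]
  exact h

/-- **Lemma 4.3 over `ℚ`, member `E`, finite places**: if `res u' = c'_K(m)` then `[2]_* u' ∈ H¹(ℚ, E[2^M])`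
satisfies the Selmer local condition at every finite `v ∤ m` — INCLUDING `v ∣ d_K` (no genus component
survives `[2]_*`). [cite: McCallumLMS1991, §4 Lemma 4.3 and Lemma 4.6] [cite: DokchitserDokchitserAnnals2010, Lemma 4.14 (proof)] -/
theorem torsionH1ZSMul_mem_selmerLocalKer_of_notMem (h2 : Module.finrank ℚ K = 2) {m : ℕ}
    (hm : KolSupp (fun ℓ ↦ IsKolyvaginPrime N W K 2 ℓ ∧ FrobEqFrobInfty W K (2 ^ (M + 1)) ℓ ∧ S ℓ) m)
    {u' : galH1Torsion W (lvl (M + 1))} (hu' : resTorsion W K (lvl (M + 1)) u' = cK W c (M + 1) hdiv' D' m)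
    (v : HeightOneSpectrum (𝓞 ℚ)) (hv : (m : 𝓞 ℚ) ∉ v.asIdeal) :
    torsionH1ZSMul W 2 (lvl_succ_dvd M) u' ∈ selmerLocalKer W (v.adicCompletion ℚ) (lvl M) :=
  torsionH1ZSMul_two_mem_selmerLocalKer_of_forall_liesOver W K h2.le (lvl_succ_dvd M) v fun w hw ↦ by
    rw [hu']
    exact cK_mem_selmerLocalKer_of_notMem W c M hdiv' D' hm w (natCast_notMem_of_liesOver hv w hw)

/-- **Lemma 4.3 over `ℚ`, member `E`, infinite place** (nothing is asked at the complex place of `K`).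
[cite: GrossLMS1991, Prop. 6.2 (1)] [cite: McCallumLMS1991, §4 Lemma 4.3] -/
theorem torsionH1ZSMul_mem_selmerLocalKer_infinitePlace (hK : IsImaginaryQuadratic K)
    (u' : galH1Torsion W (lvl (M + 1))) (v : InfinitePlace ℚ) :
    torsionH1ZSMul W 2 (lvl_succ_dvd M) u' ∈ selmerLocalKer W v.Completion (lvl M) := by
  haveI : Algebra.IsAlgebraic ℚ K := Algebra.IsAlgebraic.of_finite ℚ K
  exact torsionH1ZSMul_two_mem_selmerLocalKer_infinitePlace_of_forall_comap W K (lvl_succ_dvd M) v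
    fun w _ ↦ mem_selmerLocalKer_infinitePlace_of_isImaginaryQuadratic hK _ w _

/-- **Lemma 4.3 over `ℚ`, member `E`, in the currency `loc₁`/`Dv` of the pair data**: `[2]_* u' ∈ loc₁ v` at every
place `v` of `ℚ` with `¬ Dv v m`. [cite: McCallumLMS1991, §4 Lemma 4.3] -/
theorem torsionH1ZSMul_mem_loc₁_of_notDv (hK : IsImaginaryQuadratic K) {m : ℕ}
    (hm : KolSupp (fun ℓ ↦ IsKolyvaginPrime N W K 2 ℓ ∧ FrobEqFrobInfty W K (2 ^ (M + 1)) ℓ ∧ S ℓ) m)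
    {u' : galH1Torsion W (lvl (M + 1))} (hu' : resTorsion W K (lvl (M + 1)) u' = cK W c (M + 1) hdiv' D' m)
    (v : HeightOneSpectrum (𝓞 ℚ) ⊕ InfinitePlace ℚ) (hv : ¬ Dv v m) :
    torsionH1ZSMul W 2 (lvl_succ_dvd M) u' ∈ loc₁ W M v := by
  rcases v with v | v
  · exact torsionH1ZSMul_mem_selmerLocalKer_of_notMem W c M hdiv' D' hK.1 hm hu' v hv
  · exact torsionH1ZSMul_mem_selmerLocalKer_infinitePlace W M hK u' v

variable {θ : K} (hθ : θ ∉ Set.range (algebraMap ℚ K)) (hd : θ ^ 2 = algebraMap ℚ K ((NumberField.discr K : ℤ) : ℚ))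

/-- **Lemma 4.3 over `ℚ`, member `E^{(d_K)}`, finite places**: if `ψ(res y') = c'_K(m)` then
`[2]_* y' ∈ H¹(ℚ, E^{(d_K)}[2^M])` is Selmer at every finite `v ∤ m` (`ψ` respects the local conditions).
[cite: McCallumLMS1991, §4 Lemma 4.3 and Lemma 4.6] [cite: Kolyvagin1989Izv, §3] [cite: DokchitserDokchitserAnnals2010, Lemma 4.14 (proof)] -/
theorem torsionH1ZSMul_twin_mem_selmerLocalKer_of_notMem (h2 : Module.finrank ℚ K = 2) {m : ℕ}
    (hm : KolSupp (fun ℓ ↦ IsKolyvaginPrime N W K 2 ℓ ∧ FrobEqFrobInfty W K (2 ^ (M + 1)) ℓ ∧ S ℓ) m)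
    {y' : galH1Torsion (twin W K) (lvl (M + 1))}
    (hy' : hPsiKT W K hθ hd (lvl (M + 1)) (resTorsion (twin W K) K (lvl (M + 1)) y') =
      cK W c (M + 1) hdiv' D' m)
    (v : HeightOneSpectrum (𝓞 ℚ)) (hv : (m : 𝓞 ℚ) ∉ v.asIdeal) :
    torsionH1ZSMul (twin W K) 2 (lvl_succ_dvd M) y' ∈ selmerLocalKer (twin W K) (v.adicCompletion ℚ) (lvl M) :=
  torsionH1ZSMul_two_mem_selmerLocalKer_of_forall_liesOver (twin W K) K h2.le (lvl_succ_dvd M) v fun w hw ↦ by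
    rw [mem_selmerLocalKer_iff_hPsiKT_mem W K hθ hd (lvl (M + 1)) (w.adicCompletion K), hy']
    exact cK_mem_selmerLocalKer_of_notMem W c M hdiv' D' hm w (natCast_notMem_of_liesOver hv w hw)

/-- **Lemma 4.3 over `ℚ`, member `E^{(d_K)}`, infinite place.** [cite: GrossLMS1991, Prop. 6.2 (1)] -/
theorem torsionH1ZSMul_twin_mem_selmerLocalKer_infinitePlace (hK : IsImaginaryQuadratic K)
    (y' : galH1Torsion (twin W K) (lvl (M + 1))) (v : InfinitePlace ℚ) :
    torsionH1ZSMul (twin W K) 2 (lvl_succ_dvd M) y' ∈ selmerLocalKer (twin W K) v.Completion (lvl M) := by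
  haveI : Algebra.IsAlgebraic ℚ K := Algebra.IsAlgebraic.of_finite ℚ K
  exact torsionH1ZSMul_two_mem_selmerLocalKer_infinitePlace_of_forall_comap (twin W K) K (lvl_succ_dvd M) v
    fun w _ ↦ mem_selmerLocalKer_infinitePlace_of_isImaginaryQuadratic (W := twin W K) hK _ w _

/-- **Lemma 4.3 over `ℚ`, member `E^{(d_K)}`, in the currency `loc₂`/`Dv`.** [cite: McCallumLMS1991, §4 Lemma 4.3] -/
theorem torsionH1ZSMul_twin_mem_loc₂_of_notDv (hK : IsImaginaryQuadratic K) {m : ℕ}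
    (hm : KolSupp (fun ℓ ↦ IsKolyvaginPrime N W K 2 ℓ ∧ FrobEqFrobInfty W K (2 ^ (M + 1)) ℓ ∧ S ℓ) m)
    {y' : galH1Torsion (twin W K) (lvl (M + 1))}
    (hy' : hPsiKT W K hθ hd (lvl (M + 1)) (resTorsion (twin W K) K (lvl (M + 1)) y') =
      cK W c (M + 1) hdiv' D' m)
    (v : HeightOneSpectrum (𝓞 ℚ) ⊕ InfinitePlace ℚ) (hv : ¬ Dv v m) :
    torsionH1ZSMul (twin W K) 2 (lvl_succ_dvd M) y' ∈ loc₂ W K M v := by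
  rcases v with v | v
  · exact torsionH1ZSMul_twin_mem_selmerLocalKer_of_notMem W c M hdiv' D' hθ hd hK.1 hm hy' v hv
  · exact torsionH1ZSMul_twin_mem_selmerLocalKer_infinitePlace W M hK y' v

end Lemma43

/-! ## §3 The Kolyvagin relation over `K` at level `2^M` for the classes `[2]_* c'_K` -/

section Relation

variable (D' : PointSystem N W K P 2 S (M + 1) hdiv' c)

/-- Gross 6.2 (2) over `K` at level `2^{M+1}` (field `rel`): at `λ ∣ ℓ ∣ ℓm`,
`2^b c'_K(ℓm)` Selmer at `λ` iff `2^b c'_K(m)` vanishes at `λ`. [cite: GrossLMS1991, Prop. 6.2 (2)] [cite: McCallumLMS1991, §4 Prop. 4.4] -/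
theorem zsmul_cK_mem_selmerLocalKer_iff {ℓ m : ℕ}
    (hℓ : IsKolyvaginPrime N W K 2 ℓ ∧ FrobEqFrobInfty W K (2 ^ (M + 1)) ℓ ∧ S ℓ)
    (hℓm : KolSupp (fun ℓ ↦ IsKolyvaginPrime N W K 2 ℓ ∧ FrobEqFrobInfty W K (2 ^ (M + 1)) ℓ ∧ S ℓ) (ℓ * m))
    (w : HeightOneSpectrum (𝓞 K)) (hw : (ℓ : 𝓞 K) ∈ w.asIdeal) (b : ℕ) :
    (((2 : ℕ) : ℤ) ^ b) • cK W c (M + 1) hdiv' D' (ℓ * m) ∈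
        selmerLocalKer (W.baseChange K) (w.adicCompletion K) (lvl (M + 1)) ↔
      (((2 : ℕ) : ℤ) ^ b) • cK W c (M + 1) hdiv' D' m ∈
        (W.baseChange K).torsionLocalKer (w.adicCompletion K) (lvl (M + 1)) := by
  have hℓp : ℓ.Prime := hℓ.1.prime
  have hrel := (D'.rel (ℓ * m) hℓm.1 hℓm.2).2.2 ℓ hℓp (dvd_mul_right ℓ m) w hw b
  rw [Nat.mul_div_cancel_left m hℓp.pos] at hrel
  exact hrel

/-- **`Γ_{K_λ}` fixes `E_K[2^{M+1}]` at a depth-`(M+1)` Kolyvagin prime `ℓ` of good reduction** (`P` a Heegner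
point of level `N`, so `ℓ ∤ N` is good): McCallum's «`E(K_λ)_{p^{M}} = E_{p^{M}}`» one level deeper.
[cite: McCallumLMS1991, §4 (E(K_λ)_{p^M} = E_{p^M})] [cite: GrossLMS1991, §3 (3.2)] -/
theorem resGal_smul_geomTorsion_eq [NeZero N] [W.IsElliptic] (hK : IsImaginaryQuadratic K)
    (hP : IsHeegnerPoint N W K P) {ℓ : ℕ} (hℓ : IsKolyvaginPrime N W K 2 ℓ)
    (hℓM : FrobEqFrobInfty W K (2 ^ (M + 1)) ℓ)
    (g : absoluteGaloisGroup (hℓ.place.adicCompletion K))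
    (Q : geomTorsion (W.baseChange K) ((2 ^ (M + 1) : ℕ) : ℤ)) :
    resGal (K := K) (hℓ.place.adicCompletion K) g • Q = Q := by
  rw [resGal_eq_absGaloisRestrict]
  exact absGaloisRestrict_smul_geomTorsion_eq_of_kolyvaginPrime_pow W hK hP Nat.prime_two hℓ (M + 1) hℓM g Q

/-- **THE KOLYVAGIN RELATION AT LEVEL `2^M` FOR THE CLASSES `[2]_* c'_K`**: at `λ ∣ ℓ ∣ ℓm`,
`2^a [2]_* c'_K(ℓm)` Selmer at `λ` iff `2^a [2]_* c'_K(m)` vanishes at `λ` — Gross 6.2 (2) at level `2^{M+1}`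
with multiplier `2^{a+1}`, moved through `[2]_*` (Selmer side: image in `H¹(K_λ, E)`; strict side: `ι_*`
injective at `λ` since `Γ_{K_λ}` fixes `E[2^{M+1}]`). [cite: GrossLMS1991, Prop. 6.2 (2)]
[cite: McCallumLMS1991, §4 Prop. 4.4 and Lemma 4.6] -/
theorem zsmul_torsionH1ZSMul_cK_mem_selmerLocalKer_iff [NeZero N] [W.IsElliptic] (hK : IsImaginaryQuadratic K)
    (hP : IsHeegnerPoint N W K P) {ℓ m : ℕ}
    (hℓ : IsKolyvaginPrime N W K 2 ℓ ∧ FrobEqFrobInfty W K (2 ^ (M + 1)) ℓ ∧ S ℓ)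
    (hℓm : KolSupp (fun ℓ ↦ IsKolyvaginPrime N W K 2 ℓ ∧ FrobEqFrobInfty W K (2 ^ (M + 1)) ℓ ∧ S ℓ) (ℓ * m))
    (w : HeightOneSpectrum (𝓞 K)) (hw : (ℓ : 𝓞 K) ∈ w.asIdeal) (a : ℕ) :
    (((2 : ℕ) : ℤ) ^ a) • torsionH1ZSMul (W.baseChange K) 2 (lvl_succ_dvd M) (cK W c (M + 1) hdiv' D' (ℓ * m)) ∈
        selmerLocalKer (W.baseChange K) (w.adicCompletion K) (lvl M) ↔
      (((2 : ℕ) : ℤ) ^ a) • torsionH1ZSMul (W.baseChange K) 2 (lvl_succ_dvd M) (cK W c (M + 1) hdiv' D' m) ∈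
        (W.baseChange K).torsionLocalKer (w.adicCompletion K) (lvl M) := by
  obtain rfl : w = hℓ.1.place := hℓ.1.mem_iff.mp hw
  have htriv := resGal_smul_geomTorsion_eq W M hK hP hℓ.1 hℓ.2.1
  rw [zsmul_torsionH1ZSMul_mem_selmerLocalKer_iff,
    zsmul_torsionH1ZSMul_mem_torsionLocalKer_iff_of_fixed (W.baseChange K) _ (two_pow_dvd_two_pow_succ M)
      (pow_ne_zero M two_ne_zero) (pow_ne_zero (M + 1) two_ne_zero) 2 (lvl_succ_dvd M) htriv,
    natCast_two_pow_mul_two]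
  exact zsmul_cK_mem_selmerLocalKer_iff W c M hdiv' D' hℓ hℓm _ hw (a + 1)

end Relation

/-! ## §4 Prop. 4.4 ACROSS the pair over `ℚ` at level `2^M` -/

section PropFourFour

variable {θ : K} (hθ : θ ∉ Set.range (algebraMap ℚ K))
  (hd : θ ^ 2 = algebraMap ℚ K ((NumberField.discr K : ℤ) : ℚ))
  (D' : PointSystem N W K P 2 S (M + 1) hdiv' c)

/-- The per-prime data of a Kolyvagin prime `ℓ` with `kolPrime W K M ℓ` on the Heegner habitat: the place
`v_ℓ` of `ℚ`, `λ ∣ v_ℓ` of residue degree `2`, good reduction of `E` and `E^{(d_K)}` at `v_ℓ`, `d_K ∉ v_ℓ`,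
`Frob_ℓ ∼ τ` on `E[2^M]` and on `E^{(d_K)}[2^M]`, `Δ(E^{(d_K)}) < 0`. [cite: GrossLMS1991, §3 (3.1)–(3.2)] -/
theorem kolPrime_localData [NeZero N] [W.IsElliptic] [W.IsGloballyMinimal] [(twin W K).IsElliptic]
    (h2 : Module.finrank ℚ K = 2) (hK : IsImaginaryQuadratic K)
    (hodd : Odd (NumberField.discr K)) (hΔ : W.Δ < 0) {ℓ : ℕ} (hℓ : IsKolyvaginPrime N W K 2 ℓ)
    (hkol : kolPrime W K M ℓ) :
    (ℓ : 𝓞 ℚ) ∈ (primesEquiv.symm ⟨ℓ, hℓ.prime⟩ : HeightOneSpectrum (𝓞 ℚ)).asIdeal ∧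
      hℓ.place.asIdeal.LiesOver (primesEquiv.symm ⟨ℓ, hℓ.prime⟩ : HeightOneSpectrum (𝓞 ℚ)).asIdeal ∧
      hℓ.place.asIdeal.inertiaDeg (𝓞 ℚ) = 2 ∧
      W.HasGoodReductionAt (primesEquiv.symm ⟨ℓ, hℓ.prime⟩ : HeightOneSpectrum (𝓞 ℚ)) ∧
      (twin W K).HasGoodReductionAt (primesEquiv.symm ⟨ℓ, hℓ.prime⟩ : HeightOneSpectrum (𝓞 ℚ)) ∧
      ((NumberField.discr K : ℤ) : 𝓞 ℚ) ∉ (primesEquiv.symm ⟨ℓ, hℓ.prime⟩ : HeightOneSpectrum (𝓞 ℚ)).asIdeal ∧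
      FrobEqFrobInfty W K (2 ^ M) ℓ ∧ FrobEqFrobInfty (twin W K) K (2 ^ M) ℓ ∧ (twin W K).Δ < 0 := by
  have hℓp : ℓ.Prime := hℓ.prime
  haveI : Fact ℓ.Prime := ⟨hℓp⟩
  obtain ⟨hℓv, hLO, hf2⟩ := place_liesOver_and_inertiaDeg W h2 hℓ
  obtain ⟨_, -, -, hgood, hℓM, -, -, -⟩ := hkol
  have hdQ : ((NumberField.discr K : ℤ) : ℚ) ≠ 0 := by exact_mod_cast NumberField.discr_ne_zero K
  have hC1 : (1 : VariableChange ℚ) • W.quadraticTwist ((NumberField.discr K : ℤ) : ℚ) = twin W K :=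
    one_smul _ _
  have hgoodv : W.HasGoodReductionAt (primesEquiv.symm ⟨ℓ, hℓp⟩ : HeightOneSpectrum (𝓞 ℚ)) :=
    (hasGoodReductionAtPrime_primesEquiv_iff_holds W _ ℓ (primesEquiv_eq_of_natCast_mem hℓp hℓv)).mp hgood
  have hgood' : (twin W K).HasGoodReductionAtPrime ℓ :=
    hasGoodReductionAtPrime_of_smul_quadraticTwist_eq W h2 hodd (twin W K) hC1 hℓ.2.2.1 hgood
  have hgoodv' : (twin W K).HasGoodReductionAt (primesEquiv.symm ⟨ℓ, hℓp⟩ : HeightOneSpectrum (𝓞 ℚ)) :=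
    (hasGoodReductionAtPrime_primesEquiv_iff_holds (twin W K) _ ℓ (primesEquiv_eq_of_natCast_mem hℓp hℓv)).mp
      hgood'
  exact ⟨hℓv, hLO, hf2, hgoodv, hgoodv', intCast_notMem_of_not_dvd hℓp hℓv hℓ.2.2.1, hℓM,
    frobEqFrobInfty_of_smul_quadraticTwist_eq W hK (twin W K) hC1 hℓM,
    Δ_neg_of_smul_quadraticTwist_eq W hdQ (twin W K) hC1 hΔ⟩

/-- **Prop. 4.4 over `ℚ`, even depth `m` → odd depth `ℓm` (field `c_mem_loc_iff₁₂` of `PairDataM`)** for the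
level-`2^M` classes `[2]_* u'` (`res u' = c'_K(m)`) and `[2]_* y'` (`ψ(res y') = c'_K(ℓm)`): for every `a`,
`2^a [2]_* y' ∈ loc₂ (pl ℓ) ⟺ 2^a [2]_* u' ∈ a₁ ℓ`. [cite: McCallumLMS1991, §4 Prop. 4.4]
[cite: GrossLMS1991, Prop. 6.2 (2)] [cite: Kolyvagin1989Izv, §3] -/
theorem zsmul_torsionH1ZSMul_twin_mem_loc₂_iff_mem_a₁ [NeZero N] [W.IsElliptic] [W.IsGloballyMinimal]
    [(twin W K).IsElliptic] (h2 : Module.finrank ℚ K = 2) (hK : IsImaginaryQuadratic K) (hodd : Odd (NumberField.discr K)) (hΔ : W.Δ < 0)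
    (hP : IsHeegnerPoint N W K P) (hM : 1 ≤ M) {ℓ m : ℕ}
    (hℓ : IsKolyvaginPrime N W K 2 ℓ ∧ FrobEqFrobInfty W K (2 ^ (M + 1)) ℓ ∧ S ℓ) (hkol : kolPrime W K M ℓ)
    (hℓm : KolSupp (fun ℓ ↦ IsKolyvaginPrime N W K 2 ℓ ∧ FrobEqFrobInfty W K (2 ^ (M + 1)) ℓ ∧ S ℓ) (ℓ * m))
    {u' : galH1Torsion W (lvl (M + 1))} (hu' : resTorsion W K (lvl (M + 1)) u' = cK W c (M + 1) hdiv' D' m)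
    {y' : galH1Torsion (twin W K) (lvl (M + 1))}
    (hy' : hPsiKT W K hθ hd (lvl (M + 1)) (resTorsion (twin W K) K (lvl (M + 1)) y') =
      cK W c (M + 1) hdiv' D' (ℓ * m)) (a : ℕ) :
    (((2 : ℕ) : ℤ) ^ a) • torsionH1ZSMul (twin W K) 2 (lvl_succ_dvd M) y' ∈ loc₂ W K M (pl ℓ) ↔
      (((2 : ℕ) : ℤ) ^ a) • torsionH1ZSMul W 2 (lvl_succ_dvd M) u' ∈ a₁ W M ℓ := by
  have hℓp : ℓ.Prime := hℓ.1.prime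
  obtain ⟨hℓv, hLO, hf2, hgoodv, hgoodv', hcv, hℓM, -, -⟩ := kolPrime_localData W M h2 hK hodd hΔ hℓ.1 hkol
  haveI := hLO
  rw [pl_of_prime hℓp, mem_a₁_iff hℓp]
  change (((2 : ℕ) : ℤ) ^ a) • torsionH1ZSMul (twin W K) 2 (lvl_succ_dvd M) y' ∈
      selmerLocalKer (twin W K) ((primesEquiv.symm ⟨ℓ, hℓp⟩ : HeightOneSpectrum (𝓞 ℚ)).adicCompletion ℚ)
        (lvl M) ↔ _
  have hu : resTorsion W K (lvl M) (torsionH1ZSMul W 2 (lvl_succ_dvd M) u') =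
      torsionH1ZSMul (W.baseChange K) 2 (lvl_succ_dvd M) (cK W c (M + 1) hdiv' D' m) := by
    rw [resTorsion_torsionH1ZSMul, hu']
  have hy : hPsiKT W K hθ hd (lvl M) (resTorsion (twin W K) K (lvl M)
      (torsionH1ZSMul (twin W K) 2 (lvl_succ_dvd M) y')) =
      torsionH1ZSMul (W.baseChange K) 2 (lvl_succ_dvd M) (cK W c (M + 1) hdiv' D' (ℓ * m)) := by
    rw [hPsiKT_resTorsion_torsionH1ZSMul, hy']
  exact zsmul_twist_mem_selmerLocalKer_iff_zsmul_mem_torsionLocalKer_of_K W hΔ hM rfl hℓp hℓ.1.2.2.2.1 hℓv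
    hgoodv h2 (not_mem_range hθ) hd hcv hℓM hℓ.1.place hf2 hθ hd hgoodv' hu hy _
    (zsmul_torsionH1ZSMul_cK_mem_selmerLocalKer_iff W c M hdiv' D' hK hP hℓ hℓm _ hℓ.1.mem_place a)

/-- **Prop. 4.4 over `ℚ`, odd depth `m` → even depth `ℓm` (field `c_mem_loc_iff₂₁`)** for the level-`2^M` classes
`[2]_* u'` (`res u' = c'_K(ℓm)`) and `[2]_* y'` (`ψ(res y') = c'_K(m)`): for every `a`,
`2^a [2]_* u' ∈ loc₁ (pl ℓ) ⟺ 2^a [2]_* y' ∈ a₂ ℓ`. [cite: McCallumLMS1991, §4 Prop. 4.4]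
[cite: GrossLMS1991, Prop. 6.2 (2)] [cite: Kolyvagin1989Izv, §3] -/
theorem zsmul_torsionH1ZSMul_mem_loc₁_iff_twin_mem_a₂ [NeZero N] [W.IsElliptic] [W.IsGloballyMinimal]
    [(twin W K).IsElliptic] (h2 : Module.finrank ℚ K = 2) (hK : IsImaginaryQuadratic K) (hodd : Odd (NumberField.discr K)) (hΔ : W.Δ < 0)
    (hP : IsHeegnerPoint N W K P) (hM : 1 ≤ M) {ℓ m : ℕ}
    (hℓ : IsKolyvaginPrime N W K 2 ℓ ∧ FrobEqFrobInfty W K (2 ^ (M + 1)) ℓ ∧ S ℓ) (hkol : kolPrime W K M ℓ)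
    (hℓm : KolSupp (fun ℓ ↦ IsKolyvaginPrime N W K 2 ℓ ∧ FrobEqFrobInfty W K (2 ^ (M + 1)) ℓ ∧ S ℓ) (ℓ * m))
    {u' : galH1Torsion W (lvl (M + 1))}
    (hu' : resTorsion W K (lvl (M + 1)) u' = cK W c (M + 1) hdiv' D' (ℓ * m))
    {y' : galH1Torsion (twin W K) (lvl (M + 1))}
    (hy' : hPsiKT W K hθ hd (lvl (M + 1)) (resTorsion (twin W K) K (lvl (M + 1)) y') =
      cK W c (M + 1) hdiv' D' m) (a : ℕ) :
    (((2 : ℕ) : ℤ) ^ a) • torsionH1ZSMul W 2 (lvl_succ_dvd M) u' ∈ loc₁ W M (pl ℓ) ↔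
      (((2 : ℕ) : ℤ) ^ a) • torsionH1ZSMul (twin W K) 2 (lvl_succ_dvd M) y' ∈ a₂ W K M ℓ := by
  have hℓp : ℓ.Prime := hℓ.1.prime
  obtain ⟨hℓv, hLO, hf2, hgoodv, hgoodv', hcv, -, hℓM', hΔ'⟩ := kolPrime_localData W M h2 hK hodd hΔ hℓ.1 hkol
  haveI := hLO
  rw [pl_of_prime hℓp, mem_a₂_iff hℓp]
  change (((2 : ℕ) : ℤ) ^ a) • torsionH1ZSMul W 2 (lvl_succ_dvd M) u' ∈
      selmerLocalKer W ((primesEquiv.symm ⟨ℓ, hℓp⟩ : HeightOneSpectrum (𝓞 ℚ)).adicCompletion ℚ) (lvl M) ↔ _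
  have hu : resTorsion W K (lvl M) (torsionH1ZSMul W 2 (lvl_succ_dvd M) u') =
      torsionH1ZSMul (W.baseChange K) 2 (lvl_succ_dvd M) (cK W c (M + 1) hdiv' D' (ℓ * m)) := by
    rw [resTorsion_torsionH1ZSMul, hu']
  have hy : hPsiKT W K hθ hd (lvl M) (resTorsion (twin W K) K (lvl M)
      (torsionH1ZSMul (twin W K) 2 (lvl_succ_dvd M) y')) =
      torsionH1ZSMul (W.baseChange K) 2 (lvl_succ_dvd M) (cK W c (M + 1) hdiv' D' m) := by
    rw [hPsiKT_resTorsion_torsionH1ZSMul, hy']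
  exact zsmul_mem_selmerLocalKer_iff_zsmul_twist_mem_torsionLocalKer_of_K W hM rfl hℓp hℓ.1.2.2.2.1 hℓv hgoodv h2
    (not_mem_range hθ) hd hcv hℓ.1.place hf2 hθ hd hΔ' hgoodv' hℓM' hu hy _
    (zsmul_torsionH1ZSMul_cK_mem_selmerLocalKer_iff W c M hdiv' D' hK hP hℓ hℓm _ hℓ.1.mem_place a)

end PropFourFour

end Summit.BirchSwinnertonDyer.BirchSwinnertonDyer.Theorems.KolyvaginPairSupplyTwo

end
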